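import Summits.QuantumFields.YangMills.Theorems.FluctuationComparisonRegPrIntLOrganTangentDwhiteOfTubeOperator
import HarnessLib

/-!
# Crux `FluctuationComparisonRegPrIntL` (stmt-QuantumFields-20520, rung R3), PATH-B organ (covariant organ of record, RULING №56) — (L60) «THE MAJORANT IS LOCALITY,
# UNIFORM IN THE TORUS»: the (K-tube) MAJORANT letter of ✓(L59) `dwhite_of_tubeOperator_window` — ONE entrywise majorant `Mx` of the complexified fluctuation
# operator on the tube with absolute row∕column sums `≤ S` — is STRUCK in favour of print's two structural facts, (K-range) «`Kc W i j′ = 0` unless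
# `d₁(loc i, loc j′) ≤ r₀`» (FINITE RANGE: the local operators of [Balaban1985BackgroundPropagators] (3.23)–(3.26) pp.394–395, [Balaban1988RG2Cluster] (2.5) p.12)
# and (K-bound) «`‖Kc W i j′‖ ≤ a` on the tube» (ONE uniform entry bound, [Balaban1985BackgroundPropagators] Thm 3.4 p.400), plus a fibre multiplicity `mf` of the
# location map; the row∕column sum is then `S := a·e^{ρm r₀}·(mf·c₀(1,ρm)^ν)` — UNIFORM IN THE TORUS SIZE by [Balaban1984PropagatorsII] Lemma 2.1 (2.61) p.234
# (lit ✓`rowSum_torus`), which is the L2-e-type m-uniformity of this letter, BY NAME.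

Cell `ym3-torus` (YM ladder rung R3 = continuum `SU(2)` Yang–Mills on the three-torus — a RUNG: NOT d = 4, NOT infinite volume, NOT a mass gap, NOT Clay).
Width seat `ym-ust-20520-w5` (gen 27), `--kind proof --supports stmt-QuantumFields-20520 --as helper`, count-neutral, DEFINITION-FREE, default heartbeats,
no registry ∕ binder ∕ `Lines/` edit.  Over ✓(L59) `…OrganTangentDwhiteOfTubeOperator` (this seat), lit ✓`B13AccretiveOfRealCoercive` §3 (`rowSum_decay_le`,
`colSum_decay_le`; the range road of `rawEntryLetters_of_range_family`), lit ✓`B13LocalKernelWalks.rowSum_torus` ([Balaban1984PropagatorsII] (2.61) on the one-scale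
torus, every size), lit ✓`B6` (`c0`), ✓`B6RandomWalk.c0_nonneg`.

THE LETTERS AFTER (L60) (hypothesis texts): (K-tube-holo) entrywise holomorphy of `Kc` on `cplxTube δt V` around every `θ_j`-small `V` (L2-c); (K-range) + (K-bound)
(locality + ONE bound, on the same tubes); `hfib` (each torus site carries `≤ mf` coordinates — bond × colour bookkeeping); (K-real), (K-coer) (L2-a, REAL, as printed),
(K-sqrt-decay) (L2-b) on the enlarged window `θ_j + 4·√3·R₁`; (Wh-read-K); (z-window∣MW), `kW`, `hkW`; radii with the margin condition now reading
`2·(a·e^{ρm r₀}·(mf·c₀(1,ρm)^ν))·R₁∕rt ≤ γK∕2` — every constant torus-size-free.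
INHABITATION (★★OWNER RULING №100): LAW-FREE — statements about the chart objects `Kc`, `K`, `Wh`, `coord` pointwise; no fibre law, no score, no cross-law object.

WHAT (sorry-free, def-free).
* §1 ★`decayMajorant_of_range` — (K-range) + (K-bound) ⟹ the decay majorant `‖Kc W i j′‖ ≤ a·e^{ρm r₀}·e^{−ρm d₁(loc i, loc j′)}` at every rate `ρm ≥ 0` (lit's range road,
  pointwise); ★`rowSum_decayMajorant_le` ∕ ★`colSum_decayMajorant_le` — its absolute row∕column sums are `≤ a·e^{ρm r₀}·(mf·c₀(1,ρm)^ν)` for `ρm > 0`, EVERY torus size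
  (lit ✓`rowSum_decay_le` ∕ ✓`colSum_decay_le` ∘ ✓`rowSum_torus`).
* §2 ★★★`dwhite_of_localTubeOperator` — ✓(L59) `dwhite_of_tubeOperator_window` with `(Mx, S, hS, hrow, hcol, hKM)` DELETED and `(r₀ a mf ρm) (ha) (hρm) (hfib) (hrange) (hbd)`
  in their place, `S := a·e^{ρm r₀}·(mf·c₀(1,ρm)^ν)` substituted into `hsmall`; CONCLUSION = ✓(L52)'s = ✓(L50b)'s `hDwhite` text VERBATIM.
NET: D0's whitening letter list = {(K-tube-holo) L2-c, (K-range)+(K-bound) locality, (K-real), (K-coer) L2-a, (K-sqrt-decay) L2-b, (Wh-read-K), (z-window∣MW)} with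
torus-size-free constants; the only m-uniformity questions left on this side are those of `a`, `r₀`, `γK`, `(B, ρ)` themselves — print's.

HONEST FRAMING: bookkeeping over HYPOTHESIS letters with lit's kernel-checked torus row sum; nothing of Bałaban's operators is constructed or asserted; (K-tube-holo),
(K-range), (K-bound), (K-real), (K-coer), (K-sqrt-decay), (Wh-read-K), (z-window∣MW) are D0's ∕ print's content (crux 19200 EX ∧ V2′; [Balaban1985BackgroundPropagators]
§3) and are NOT proved here; (Dmin), (χ-Lip∣MW), (I-curv), (I-cov), KER′ letters, rows v0.1–v0.4ᴱ UNDISCHARGED; the five registered stubs of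
`Lines/semiclassical_s2beta.lean`, crux 20520 and `YM3TorusSU2` are NOT proved; registry untouched; rung R3 = SU(2) YM₃ on T³ — NOT d = 4, NOT infinite volume, NOT a
mass gap, NOT Clay; the Yang–Mills mass gap is NOT proved.  [folklore]

References: T. Bałaban, CMP **96** (1984) 223–250 [Balaban1984PropagatorsII] ((2.52) p.232, Lemma 2.1 (2.61) p.234); CMP **99** (1985) 389–434
[Balaban1985BackgroundPropagators] ((3.23)–(3.26) pp.394–395, Thm 3.4 p.400, Thm 3.10 (3.108) p.416, Thm 3.11 p.416, p.428); CMP **116** (1988) 1–22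
[Balaban1988RG2Cluster] ((2.5)–(2.7) pp.12–13, p.15); CMP **109** (1987) 249–301 [Balaban1987RG1] ((1.11)–(1.18) pp.262–263).
-/

set_option autoImplicit false

noncomputable section

namespace Summit.QuantumFields.YangMills.Theorems.OrganTangentDwhiteOfLocalTubeOperator

open Function Set Metric Finset
open scoped NNReal Matrix Matrix.Norms.L2Operator
open Literature.MathematicalPhysics.QuantumFieldTheory
open Literature.MathematicalPhysics.QuantumFieldTheory.Balaban1983to89 T3ContinuumYM3Torus T3NestedUnitLaws
  T3UnitLawDensityEML T4Continuum BalabanUVClass T3UnitScaleTilt T3LevelShift T3TiltDescent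
open T4CubeChartExp (expPt)
open BalabanUVClass (CplxModel)
open Literature.MathematicalPhysics.QuantumFieldTheory.Balaban1983to89.B9Thm37GlueTorus (tdist1)
open Literature.MathematicalPhysics.QuantumFieldTheory.Balaban1983to89.B5TorusCover (UT)
open Literature.MathematicalPhysics.QuantumFieldTheory.Balaban1983to89.B13Sqrt27Accretive (invSqrt)
open Literature.MathematicalPhysics.QuantumFieldTheory.Balaban1983to89.B13RealSliceEntryLetters (realStructureComplex lam)
open Literature.MathematicalPhysics.QuantumFieldTheory.Balaban1983to89.QGQInverse (Coercive)
open Literature.MathematicalPhysics.QuantumFieldTheory.Balaban1983to89.B13AccretiveOfRealCoercive (rowSum_decay_le colSum_decay_le)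
open Literature.MathematicalPhysics.QuantumFieldTheory.Balaban1983to89.B13LocalKernelWalks (rowSum_torus)
open Summit.QuantumFields.YangMills.Theorems.OrganTangentDwhiteOfTubeOperator (dwhite_of_tubeOperator_window)

/-! ## §1 The decay majorant of a finite-range family and its torus row sums -/

section Range

variable {ν : ℕ} {Nf : Fin ν → ℕ} [∀ i, NeZero (Nf i)]
variable {p : Type} [Fintype p]

omit [Fintype p] in
/-- ★ **RANGE + ONE BOUND ⟹ THE DECAY MAJORANT** (pointwise): if `M i j′ = 0` unless `d₁(loc i, loc j′) ≤ r₀` and `‖M i j′‖ ≤ a`, then for every rate `ρm ≥ 0`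
`‖M i j′‖ ≤ a·e^{ρm r₀}·e^{−ρm d₁(loc i, loc j′)}` (lit's range road `rawEntryLetters_of_range_family`, one matrix at a time).
[cite: Balaban1985BackgroundPropagators, (3.23)-(3.26) pp.394-395; Balaban1988RG2Cluster, (2.5) p.12] -/
theorem decayMajorant_of_range (loc : p → UT Nf) {M : Matrix p p ℂ} {r₀ a ρm : ℝ} (ha : 0 ≤ a) (hρm : 0 ≤ ρm)
    (hrange : ∀ i j', M i j' ≠ 0 → tdist1 Nf (loc i) (loc j') ≤ r₀) (hbd : ∀ i j', ‖M i j'‖ ≤ a) (i j' : p) :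
    ‖M i j'‖ ≤ a * Real.exp (ρm * r₀) * Real.exp (-(ρm * tdist1 Nf (loc i) (loc j'))) := by
  by_cases h0 : M i j' = 0
  · rw [h0, norm_zero]; positivity
  · have hd := hrange i j' h0
    calc ‖M i j'‖ ≤ a * 1 := by rw [mul_one]; exact hbd i j'
      _ ≤ a * (Real.exp (ρm * r₀) * Real.exp (-(ρm * tdist1 Nf (loc i) (loc j')))) := by
          refine mul_le_mul_of_nonneg_left ?_ ha
          rw [← Real.exp_add]
          exact Real.one_le_exp (by nlinarith)
      _ = a * Real.exp (ρm * r₀) * Real.exp (-(ρm * tdist1 Nf (loc i) (loc j'))) := by ring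

/-- ★ **THE ROW SUMS OF THE DECAY MAJORANT ARE TORUS ROW SUMS, EVERY TORUS SIZE**: with a fibre multiplicity `mf` of `loc` and a rate `ρm > 0`,
`Σ_{j′} a·e^{ρm r₀}·e^{−ρm d₁(loc i, loc j′)} ≤ a·e^{ρm r₀}·(mf·c₀(1,ρm)^ν)` (lit ✓`rowSum_decay_le` ∘ ✓`rowSum_torus`). [cite: Balaban1984PropagatorsII, (2.52) p.232, Lemma 2.1 (2.61) p.234] -/
theorem rowSum_decayMajorant_le (loc : p → UT Nf) {r₀ a ρm : ℝ} {mf : ℕ} (ha : 0 ≤ a) (hρm : 0 < ρm)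
    (hfib : ∀ y : UT Nf, (univ.filter fun k => loc k = y).card ≤ mf) (i : p) :
    ∑ j', a * Real.exp (ρm * r₀) * Real.exp (-(ρm * tdist1 Nf (loc i) (loc j'))) ≤ a * Real.exp (ρm * r₀) * (mf * B6.c0 1 ρm ^ ν) :=
  rowSum_decay_le (by positivity) hfib (fun x => rowSum_torus Nf hρm x) i

/-- ★ **THE COLUMN SUMS** (symmetry of `d₁`). [cite: Balaban1984PropagatorsII, (2.52) p.232, Lemma 2.1 (2.61) p.234] -/
theorem colSum_decayMajorant_le (loc : p → UT Nf) {r₀ a ρm : ℝ} {mf : ℕ} (ha : 0 ≤ a) (hρm : 0 < ρm)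
    (hfib : ∀ y : UT Nf, (univ.filter fun k => loc k = y).card ≤ mf) (j' : p) :
    ∑ i, a * Real.exp (ρm * r₀) * Real.exp (-(ρm * tdist1 Nf (loc i) (loc j'))) ≤ a * Real.exp (ρm * r₀) * (mf * B6.c0 1 ρm ^ ν) :=
  colSum_decay_le (by positivity) hfib (fun x => rowSum_torus Nf hρm x) j'

end Range

/-! ## §2 (Dwhite∣MW) on print's two objects, the majorant from locality -/

section Dock

variable {ν : ℕ} {Nf : Fin ν → ℕ} [∀ i, NeZero (Nf i)]
variable {p : Type} [Fintype p] [DecidableEq p]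

/-- ★★★ **(Dwhite∣MW) ON PRINT'S TWO OBJECTS — THE MAJORANT FROM LOCALITY, UNIFORM IN THE TORUS** — ✓(L59) `dwhite_of_tubeOperator_window` with the majorant letters
`(Mx, S, hS, hrow, hcol, hKM)` DELETED and (K-range) `hrange` + (K-bound) `hbd` + the fibre multiplicity `hfib` + a rate `ρm > 0` in their place; the margin condition
reads `2·(a·e^{ρm r₀}·(mf·c₀(1,ρm)^ν))·R₁∕rt ≤ γK∕2` (torus-size-free).  CONCLUSION = ✓(L52)'s = ✓`dlinkPath∕Square_of_dmin_dwhite`'s `hDwhite` text VERBATIM.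
[cite: Balaban1984PropagatorsII, Lemma 2.1 (2.61) p.234; Balaban1985BackgroundPropagators, (3.23)-(3.26) pp.394-395, Thm 3.4 p.400, Thm 3.11 p.416, p.428; Balaban1988RG2Cluster, (2.5)-(2.7) pp.12-13, p.15] -/
theorem dwhite_of_localTubeOperator (F : T3Family) (γ b₀ p₀ : ℝ) (j Ts : ℕ) {Z : Type}
    (Φ : GaugeField (F.P j) 0 ↥(Matrix.specialUnitaryGroup (Fin 2) ℂ) × Z → GaugeField (F.P Ts) 0 ↥(Matrix.specialUnitaryGroup (Fin 2) ℂ))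
    (Wh : GaugeField (F.P j) 0 ↥(Matrix.specialUnitaryGroup (Fin 2) ℂ) → Z → PBond (F.P Ts) 0 → (Fin 3 → ℝ))
    (loc : p → UT Nf) (idx : PBond (F.P Ts) 0 → Fin 3 → p) (coord : Z → p → ℂ)
    (Kc : (PBond (F.P j) 0 → Matrix (Fin 2) (Fin 2) ℂ) → Matrix p p ℂ)
    (K : GaugeField (F.P j) 0 ↥(Matrix.specialUnitaryGroup (Fin 2) ℂ) → Matrix p p ℝ)
    (δt rt : ℝ) (hrt0 : 0 < rt) (hrt : Real.exp (6 * rt) ≤ 1 + δt)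
    -- (K-tube-holo): L2-c, entrywise, around every `θ_j`-small `V`
    (hKc : ∀ V : GaugeField (F.P j) 0 ↥(Matrix.specialUnitaryGroup (Fin 2) ℂ), PlaqSmall (θBal F.L γ b₀ p₀ j) V →
      ∀ i j', DifferentiableOn ℂ (fun W => Kc W i j') ((CplxModel.specialUnitary (Fin 2)).cplxTube δt V))
    -- (K-range) + (K-bound) on the same tubes; fibre multiplicity of `loc`; a summation rate `ρm > 0`
    (r₀ a ρm : ℝ) (mf : ℕ) (ha : 0 ≤ a) (hρm : 0 < ρm)
    (hfib : ∀ y : UT Nf, (univ.filter fun k => loc k = y).card ≤ mf)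
    (hrange : ∀ V : GaugeField (F.P j) 0 ↥(Matrix.specialUnitaryGroup (Fin 2) ℂ), PlaqSmall (θBal F.L γ b₀ p₀ j) V →
      ∀ W ∈ (CplxModel.specialUnitary (Fin 2)).cplxTube δt V, ∀ i j', Kc W i j' ≠ 0 → tdist1 Nf (loc i) (loc j') ≤ r₀)
    (hbd : ∀ V : GaugeField (F.P j) 0 ↥(Matrix.specialUnitaryGroup (Fin 2) ℂ), PlaqSmall (θBal F.L γ b₀ p₀ j) V →
      ∀ W ∈ (CplxModel.specialUnitary (Fin 2)).cplxTube δt V, ∀ i j', ‖Kc W i j'‖ ≤ a)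
    -- (K-coer): L2-a, REAL, at the `θ_j`-small centres
    (γK : ℝ) (hγK : 0 < γK)
    (hcoer : ∀ V : GaugeField (F.P j) 0 ↥(Matrix.specialUnitaryGroup (Fin 2) ℂ), PlaqSmall (θBal F.L γ b₀ p₀ j) V → Coercive (K V) γK)
    -- radii; the margin condition with the torus-size-free row sum
    (ρ B R₁ r δ₀ Zw : ℝ) (hB0 : 0 ≤ B) (hρ : 0 ≤ ρ) (hR₁ : 0 < R₁) (hR₁rt : R₁ ≤ rt)
    (hsmall : 2 * (a * Real.exp (ρm * r₀) * (mf * B6.c0 1 ρm ^ ν)) * R₁ / rt ≤ γK / 2)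
    (hr0 : 0 < r) (hr1 : r < 1) (hZw : 0 ≤ Zw) (hδ₀R : δ₀ < r / (1 + r) * R₁ / 2)
    -- (K-real) and (K-sqrt-decay) on the enlarged window `θ_j + 4·√3·R₁`
    (hKreal : ∀ V' : GaugeField (F.P j) 0 ↥(Matrix.specialUnitaryGroup (Fin 2) ℂ), PlaqSmall (θBal F.L γ b₀ p₀ j + 4 * (Real.sqrt 3 * R₁)) V' →
      Kc ((CplxModel.specialUnitary (Fin 2)).embed V') = (K V').map (algebraMap ℝ ℂ))
    (hdec : ∀ V' : GaugeField (F.P j) 0 ↥(Matrix.specialUnitaryGroup (Fin 2) ℂ), PlaqSmall (θBal F.L γ b₀ p₀ j + 4 * (Real.sqrt 3 * R₁)) V' →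
      ∀ i j', ‖invSqrt ((K V').map (algebraMap ℝ ℂ)) i j'‖ ≤ B * Real.exp (-(ρ * tdist1 Nf (loc i) (loc j'))))
    -- (Wh-read-K)
    (hWh : ∀ V' : GaugeField (F.P j) 0 ↥(Matrix.specialUnitaryGroup (Fin 2) ℂ), PlaqSmall (θBal F.L γ b₀ p₀ j) V' →
      ∀ (z : Z) (e : PBond (F.P Ts) 0) (k : Fin 3), Wh V' z e k = ((invSqrt ((K V').map (algebraMap ℝ ℂ)) *ᵥ coord z) (idx e k)).re)
    -- (z-window∣MW) VERBATIM
    (hwin : ∀ (z : Z) (V : GaugeField (F.P j) 0 ↥(Matrix.specialUnitaryGroup (Fin 2) ℂ)) (b : PBond (F.P j) 0) (u : Fin 3 → ℝ), PlaqSmall (θBal F.L γ b₀ p₀ j) V →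
      PlaqSmall (θBal F.L γ b₀ p₀ j) (update V b (V b * expPt u)) → ‖u‖ ≤ δ₀ →
      (∀ r ∈ Set.Ioo (0:ℝ) 1, ∀ (n : ℕ) (hjn : j + 1 ≤ n) (hnK : n ≤ Ts), PlaqSmall (24 / 25 * θBal F.L γ b₀ p₀ n) (descendTo F ℰp n Ts hnK (Φ (update V b (V b * expPt (r • u)), z)))) →
      ∀ j', ‖coord z j'‖ ≤ Zw)
    (kW : PBond (F.P Ts) 0 → ℝ)
    (hkW : ∀ e k, (4 / (r / (1 + r) * R₁)) *
          (∑ j', (B ^ (1 - lam r) * (max B (2 / Real.sqrt (γK / 2))) ^ lam r) * Real.exp (-((1 - lam r) * ρ * tdist1 Nf (loc (idx e k)) (loc j')))) * Zw ≤ kW e) :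
    ∀ (z : Z) (V : GaugeField (F.P j) 0 ↥(Matrix.specialUnitaryGroup (Fin 2) ℂ)) (b : PBond (F.P j) 0) (u : Fin 3 → ℝ), PlaqSmall (θBal F.L γ b₀ p₀ j) V →
      PlaqSmall (θBal F.L γ b₀ p₀ j) (update V b (V b * expPt u)) → ‖u‖ ≤ δ₀ →
      (∀ r ∈ Set.Ioo (0:ℝ) 1, ∀ (n : ℕ) (hjn : j + 1 ≤ n) (hnK : n ≤ Ts), PlaqSmall (24 / 25 * θBal F.L γ b₀ p₀ n) (descendTo F ℰp n Ts hnK (Φ (update V b (V b * expPt (r • u)), z)))) →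
      ∀ e, ‖Wh (update V b (V b * expPt u)) z e - Wh V z e‖ ≤ kW e * ‖u‖ :=
  dwhite_of_tubeOperator_window F γ b₀ p₀ j Ts Φ Wh loc idx coord Kc K δt rt hrt0 hrt
    (fun i j' => a * Real.exp (ρm * r₀) * Real.exp (-(ρm * tdist1 Nf (loc i) (loc j'))))
    (a * Real.exp (ρm * r₀) * (mf * B6.c0 1 ρm ^ ν))
    (by have := B6RandomWalk.c0_nonneg 1 ρm; positivity)
    (rowSum_decayMajorant_le loc ha hρm hfib) (colSum_decayMajorant_le loc ha hρm hfib) hKc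
    (fun V hV W hW i j' => decayMajorant_of_range loc ha hρm.le (hrange V hV W hW) (hbd V hV W hW) i j')
    γK hγK hcoer ρ B R₁ r δ₀ Zw hB0 hρ hR₁ hR₁rt hsmall hr0 hr1 hZw hδ₀R hKreal hdec hWh hwin kW hkW

end Dock

end Summit.QuantumFields.YangMills.Theorems.OrganTangentDwhiteOfLocalTubeOperator

end
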